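import Summits.BirchSwinnertonDyer.BirchSwinnertonDyer.Theorems.EisensteinDepletionAtTwoStarKummerSqrtFormSigma
import Summits.BirchSwinnertonDyer.BirchSwinnertonDyer.Theorems.EisensteinDepletionAtTwoStarOptBNSFKummerFn
import Summits.BirchSwinnertonDyer.BirchSwinnertonDyer.Theorems.EisensteinDepletionAtTwoStarOptBNSFX1Denominator
import Summits.BirchSwinnertonDyer.BirchSwinnertonDyer.Theorems.EisensteinDepletionAtTwoStarOptBNSFKummerQExp
import Summits.BirchSwinnertonDyer.BirchSwinnertonDyer.Theorems.EisensteinDepletionAtTwoStarOptBNSFKummerAlg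
import Summits.BirchSwinnertonDyer.BirchSwinnertonDyer.Theorems.EisensteinDepletionAtTwoStarOptBNSFParamExpansion
import Summits.BirchSwinnertonDyer.BirchSwinnertonDyer.Theorems.EisensteinDepletionAtTwoStarKummerDefs
import Literature.RingTheory.PowerSeries.NthRootDenominatorType
import Literature.NumberTheory.EllipticCurves.TwoTorsionHalfPeriodProofs
import HarnessLib

/-!
# Line `kummer` v7.2, the analytic assembly K-A′ `kummerSqrtFormSigma_theta` (corrected (Θ) hypothesis) — PROVED (crux `StarGO2Sigma`, stmt-BirchSwinnertonDyer-27046;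
# lead bsd-rank2-star-p1 GEN 13)

THE ANTI-INVARIANT CUSP FORM OF THE DISCREPANCY COVER (registered signature verbatim).  Assembly of landed engines:
`KummerFn.stub_kummerFn` (the Kummer function), `X1Denominator.stub_x1Denominator` (the rational `Γ₁(N)`-denominator),
`ParityGroup.exists_parityGroup` + `KummerForm.stub_kummerForm` (the Kummer form `hκ` on the UNTWISTED parity group),
`KummerSigma.twistedCuspForm` (Core: `h = u·hκ` on the twisted group `Γ″`), `KummerQExp.stub_kummerQExp` (the `q`-expansion
identities) and the integrality ALGEBRA in the pattern of `KummerAlg.stub_kummerAlg`, where the `2`-adic input «`B` half-integral»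
of the formal case is replaced by the eta–Kummer square identity (Θ) and the `η`-side identity `U² = q^{2m}Θ_N E²`:
`(P(h)·z²)² = (X^m·E·R·PG₁·z)²`, so `D·P(h) = ±X^m·E·R·Y·(D·PΦ₁)·z ∈ ℤ⟦q⟧` (`Y = X_W(z)⁻¹`).
v7.2 CORRECTION of the (Θ) hypothesis: the eta–Kummer square law is `Θ_N·(X(Z_q) − x₀Z_q²) = R²` with `R ∈ 1 + qℤ⟦q⟧` (planner
p2's `EtaKummerSquareLaw` shape) — the v7 form `q²·Θ_N·X_q²·(…) = Z_q²·R²` registered as `stub_etaKummerTheta` asks for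
`R·(qX/Z_q) ∈ ℤ⟦q⟧`, which fails for `|q| > 1`; this file replaces the landed `…StarKummerSqrtFormSigma` (p671127) in the skeleton.
No number theory beyond the hypotheses; nothing here reads `r_an`; `StarGO2Sigma` / E1M / BSD are NOT proved by this file.
-/

set_option linter.dupNamespace false
set_option autoImplicit false

noncomputable section

open Complex Filter Topology Set Function
open UpperHalfPlane hiding I
open scoped Real Topology Manifold MatrixGroups ModularForm
open ModularForm CongruenceSubgroup PowerSeries
open Literature.NumberTheory.EllipticCurves Literature.NumberTheory.EllipticCurves.ModularForms
open Literature.NumberTheory.EllipticCurves.Greenberg1999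
open Summit.BirchSwinnertonDyer.BirchSwinnertonDyer.Theorems.DepletionAtTwo
open Summit.BirchSwinnertonDyer.BirchSwinnertonDyer.Theorems.DepletionAtTwo.KummerAlg

namespace Summit.BirchSwinnertonDyer.BirchSwinnertonDyer.Theorems.DepletionAtTwo.KummerSigma

/-! ### §2 The stub -/

/-- **K-A′ `kummerSqrtFormSigma_theta` of line `kummer` v7.2 (crux `StarGO2Sigma`, stmt-BirchSwinnertonDyer-27046) — PROVED**: the
anti-invariant cusp form of the discrepancy cover with an integral multiple, from the square root of the Eisenstein `η`-quotient (U),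
the CORRECTED eta–Kummer square law (Θ) `Θ_N·(X(Z_q) − x₀Z_q²) = R²`, the integral parameter expansion (Z) and bounded denominators (S4).
See the file docstring. [cite: ShimuraIATAF1971, §2.4 and Thm. 7.14] [cite: SilvermanAEC2009, VI.3.6] -/
theorem kummerSqrtFormSigma_theta :
    ∀ (W₀ : WeierstrassCurve ℚ) [W₀.IsElliptic] [W₀.IsGloballyMinimal]
      ⦃N : ℕ⦄ [NeZero N] (f : CuspForm (Gamma0 N) 2), IsNewformOf W₀ f → 5 ≤ N →
      ∀ (L₀ : PeriodPair), IsNeronLatticeOf (W₀.baseChange ℂ) L₀ →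
      ∀ (q : ℤ), q ≠ 0 → (∀ z ∈ periodLattice f, (q : ℂ) * z ∈ L₀.lattice) →
      ∀ (x₀ : ℚ), HasRationalTwoTorsionX W₀ x₀ →
      ∀ (lam : ℂ), lam ∈ L₀.lattice → lam / 2 ∉ L₀.lattice →
        L₀.weierstrassP (lam / 2) - ((W₀.b₂ : ℚ) : ℂ) / 12 = ((x₀ : ℚ) : ℂ) →
      ∀ (β : ℕ → ℕ) (g' : ℚ), g' ≠ 0 →
        (∀ γ : SL(2, ℤ), γ ∈ Gamma1 N → ∃ n : ℤ, stabEisensteinPeriod N β (γ 0 0) (γ 0 1) (γ 1 0) (γ 1 1) = n * g') →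
        (∀ γ : SL(2, ℤ), γ ∈ Gamma1 N → (γ : Matrix (Fin 2) (Fin 2) ℤ).trace = 2 →
          ∃ n : ℤ, stabEisensteinPeriod N β (γ 0 0) (γ 0 1) (γ 1 0) (γ 1 1) = n * g' ∧ Even n) →
      ∀ (Γ'' : Subgroup SL(2, ℤ)),
        (∀ γ : SL(2, ℤ), γ ∈ Γ'' ↔ ∃ hγ : γ ∈ Gamma0 N, γ ∈ Gamma1 N ∧
          ((∃ n : ℤ, stabEisensteinPeriod N β (γ 0 0) (γ 0 1) (γ 1 0) (γ 1 1) = n * g' ∧ Even n) ↔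
            ∃ k : ℤ, ∃ w ∈ L₀.lattice, (q : ℂ) * cuspSymbol f ⟨γ, hγ⟩ = (k : ℂ) * lam + 2 * w)) →
      ∀ (m : ℕ) (V : ModularForm (Gamma0 N) ((24 * m : ℕ) : ℤ)) (u : UpperHalfPlane → ℂ)
        (U : PowerSeries ℚ) (E : PowerSeries ℤ),
        MDifferentiable 𝓘(ℂ) 𝓘(ℂ) u → (∀ τ : UpperHalfPlane, u τ ≠ 0) → (∀ τ : UpperHalfPlane, u τ ^ 2 = V τ) →
        (∀ γ : SL(2, ℤ), γ ∈ Gamma0 N → ∀ n : ℤ,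
          stabEisensteinPeriod N β (γ 0 0) (γ 0 1) (γ 1 0) (γ 1 1) = n * g' →
            u ∣[((12 * m : ℕ) : ℤ)] γ = ((-1 : ℂ) ^ n.natAbs) • u) →
        PowerSeries.constantCoeff U = 1 →
        (∀ n : ℕ, PowerSeries.coeff n (UpperHalfPlane.qExpansion (1 : ℝ) u) = ((PowerSeries.coeff n U : ℚ) : ℂ)) →
        PowerSeries.constantCoeff E = 1 →
        U ^ 2 = PowerSeries.map (Int.castRingHom ℚ) (PowerSeries.X ^ (2 * m) * kummerThetaSeries N * E ^ 2) →
      ∀ (R : PowerSeries ℤ), PowerSeries.constantCoeff R = 1 →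
        PowerSeries.map (Int.castRingHom ℚ) (kummerThetaSeries N) *
            (W₀.formalXMulSq - PowerSeries.C x₀ * PowerSeries.X ^ 2).subst
              (W₀.formalExp.subst ((q : ℚ) • (PowerSeries.mk fun j : ℕ ↦ ((W₀.LFunction j : ℤ) : ℚ) / j))) =
          PowerSeries.map (Int.castRingHom ℚ) R ^ 2 →
      ∀ (zq : PowerSeries ℤ),
        PowerSeries.map (Int.castRingHom ℚ) zq =
          W₀.formalExp.subst ((q : ℚ) • (PowerSeries.mk fun j : ℕ ↦ ((W₀.LFunction j : ℤ) : ℚ) / j)) →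
        (∃ A : ℝ, ∀ τ : UpperHalfPlane, A < τ.im →
          HasSum (fun n : ℕ ↦ ((PowerSeries.coeff n zq : ℤ) : ℂ) *
              Complex.exp (2 * Real.pi * Complex.I * (τ : ℂ)) ^ n)
            (-(L₀.weierstrassP ((q : ℂ) * eichlerIntegral f τ) - ((W₀.b₂ : ℚ) : ℂ) / 12) /
              ((L₀.derivWeierstrassP ((q : ℂ) * eichlerIntegral f τ)
                - ((W₀.a₁ : ℚ) : ℂ) * (L₀.weierstrassP ((q : ℂ) * eichlerIntegral f τ) - ((W₀.b₂ : ℚ) : ℂ) / 12)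
                - ((W₀.a₃ : ℚ) : ℂ)) / 2))) →
      (∀ (k : ℤ), 1 ≤ k → ∀ (F : CuspForm (Gamma1 N) k),
        (∀ n : ℕ, ∃ r : ℚ, PowerSeries.coeff n (UpperHalfPlane.qExpansion (1 : ℝ) F) = (r : ℂ)) →
        ∃ D : ℕ, D ≠ 0 ∧ ∀ n : ℕ, ∃ z : ℤ,
          PowerSeries.coeff n
            (UpperHalfPlane.qExpansion (1 : ℝ) (fun τ : UpperHalfPlane ↦ (D : ℂ) * F τ)) = (z : ℂ)) →
      ∃ (k : ℤ) (h : CuspForm Γ'' k) (M : ℕ),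
        (h : UpperHalfPlane → ℂ) ≠ 0 ∧
        (∀ γ ∈ Gamma1 N, γ ∉ Γ'' → (h : UpperHalfPlane → ℂ) ∣[k] γ = -h) ∧
        M ≠ 0 ∧
        ∀ n : ℕ, ∃ z : ℤ,
          PowerSeries.coeff n
            (UpperHalfPlane.qExpansion (1 : ℝ) (fun τ : UpperHalfPlane ↦ (M : ℂ) * h τ)) = (z : ℂ) := by
  intro W₀ _ _ N _ f hW₀ _h5 L₀ hL₀ q hq hin x₀ hx₀ lam hlam hlam2 hwp β g' hg0 hper hcusp Γ'' hΓ'' m V u U E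
    hud hune husq humul hU1 hUq hE1 hUsq R hR1 hR zq hzq hzsum hS4
  ------------------------------------------------------------------
  -- casts: the rational scale `c₁ = q`
  ------------------------------------------------------------------
  set c₁ : ℚ := (q : ℚ) with hc₁
  have hc₁0 : c₁ ≠ 0 := by rw [hc₁]; exact_mod_cast hq
  have hcast : ((c₁ : ℚ) : ℂ) = (q : ℂ) := by rw [hc₁, Rat.cast_intCast]
  have hin₁ : ∀ z ∈ periodLatticeGamma1 f, (c₁ : ℂ) * z ∈ L₀.lattice := fun z hz ↦ by
    rw [hcast]; exact hin z (periodLatticeGamma1_le_periodLattice f hz)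
  have hΓ''c : ∀ γ : SL(2, ℤ), γ ∈ Γ'' ↔ ∃ hγ : γ ∈ Gamma0 N, γ ∈ Gamma1 N ∧
      ((∃ n : ℤ, stabEisensteinPeriod N β (γ 0 0) (γ 0 1) (γ 1 0) (γ 1 1) = n * g' ∧ Even n) ↔
        ∃ k : ℤ, ∃ w ∈ L₀.lattice, (c₁ : ℂ) * cuspSymbol f ⟨γ, hγ⟩ = (k : ℂ) * lam + 2 * w) := by
    intro γ; rw [hΓ'' γ, hcast]
  ------------------------------------------------------------------
  -- the engines: Kummer function, Γ₁-denominator, untwisted parity group, Kummer form, twisted form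
  ------------------------------------------------------------------
  obtain ⟨g, hg1, hg2, hg3⟩ := KummerFn.stub_kummerFn L₀ lam hlam hlam2
  obtain ⟨k, G₁, Φ₁, hk1, hG0, hGrat, hΦ⟩ := X1Denominator.stub_x1Denominator W₀ f hW₀ L₀ hL₀ c₁ hc₁0 hin₁
  obtain ⟨Γ', hΓ'⟩ := ParityGroup.exists_parityGroup f L₀ c₁ hin₁ hlam hlam2
  obtain ⟨hκ, hκ0, hanti, hsq⟩ :=
    KummerForm.stub_kummerForm W₀ f hW₀ L₀ hL₀ c₁ hc₁0 hin₁ x₀ lam hlam hlam2 hwp Γ' hΓ' g hg1 hg2 hg3 k G₁ Φ₁ hG0 hΦ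
  set Ψ : CuspForm (Gamma1 N) k := Φ₁ - (((x₀ : ℚ) : ℂ)) • G₁ with hΨ
  have hΨapply : ∀ τ : ℍ, Ψ τ = Φ₁ τ - ((x₀ : ℚ) : ℂ) * G₁ τ := fun τ ↦ by
    simp [hΨ, CuspForm.sub_apply, CuspForm.IsGLPos.smul_apply, smul_eq_mul]
  have hsq' : ∀ τ : ℍ, hκ τ ^ 2 = Ψ τ * G₁ τ := fun τ ↦ by rw [hsq τ, hΨapply]
  have hw : ((24 * m : ℕ) : ℤ) = ((12 * m : ℕ) : ℤ) + ((12 * m : ℕ) : ℤ) := by push_cast; ring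
  set V' : ModularForm (Gamma0 N) (((12 * m : ℕ) : ℤ) + ((12 * m : ℕ) : ℤ)) := ModularForm.mcast hw V with hV'
  have husq' : ∀ τ : ℍ, u τ ^ 2 = V' τ := fun τ ↦ by rw [husq τ]; rfl
  obtain ⟨h, hhdef, hh0, hhanti, hhq⟩ :=
    twistedCuspForm f L₀ c₁ lam β g' hg0 hper hcusp hΓ' hΓ''c V' u hud hune husq' humul hκ hκ0 hanti Ψ G₁ hsq'
  ------------------------------------------------------------------
  -- the `q`-expansion identities (KummerQExp) with `B² = X − x₀T²`
  ------------------------------------------------------------------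
  have hT' : ModularGroup.T ∈ Γ' := ParityGroup.mem_of_trace_eq_two f L₀ c₁ lam hΓ' (UBD.T_mem_Gamma1 N) trace_T
  obtain ⟨B, hB0, hBsq⟩ : ∃ B : PowerSeries ℚ, constantCoeff B = 1 ∧ B ^ 2 = W₀.formalXMulSq - C x₀ * X ^ 2 := by
    apply exists_sqrt_of_constantCoeff_eq_one
    rw [map_sub, map_mul, map_pow, constantCoeff_X, zero_pow two_ne_zero, mul_zero, sub_zero,
      WeierstrassCurve.constantCoeff_formalXMulSq]
  obtain ⟨hZ0, hZ1, -⟩ := ParamExpansion.stub_paramExpansion W₀ f hW₀ L₀ hL₀ c₁ hc₁0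
  have hz0 : constantCoeff zq = 0 := by
    have h0 := congrArg constantCoeff hzq
    rw [constantCoeff_map', hZ0, eq_intCast, Int.cast_eq_zero] at h0
    exact h0
  have hz1 : coeff 1 zq ≠ 0 := by
    intro h0
    have h1 := congrArg (coeff 1) hzq
    rw [coeff_map, h0, map_zero, hZ1] at h1
    exact hc₁0 h1.symm
  have hzsum' : ∃ A : ℝ, ∀ τ : UpperHalfPlane, A < τ.im →
      HasSum (fun n : ℕ ↦ ((PowerSeries.coeff n zq : ℤ) : ℂ) * Complex.exp (2 * Real.pi * Complex.I * (τ : ℂ)) ^ n)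
        (-(L₀.weierstrassP ((c₁ : ℂ) * eichlerIntegral f τ) - ((W₀.b₂ : ℚ) : ℂ) / 12) /
          ((L₀.derivWeierstrassP ((c₁ : ℂ) * eichlerIntegral f τ)
            - ((W₀.a₁ : ℚ) : ℂ) * (L₀.weierstrassP ((c₁ : ℂ) * eichlerIntegral f τ) - ((W₀.b₂ : ℚ) : ℂ) / 12)
            - ((W₀.a₃ : ℚ) : ℂ)) / 2)) := by
    rw [hcast]; exact hzsum
  obtain ⟨hi, hii, hlinh, hlinΦ⟩ :=
    KummerQExp.stub_kummerQExp W₀ f hW₀ L₀ hL₀ c₁ hc₁0 x₀ B hB0 hBsq zq hz0 hz1 hzsum' k G₁ Φ₁ hΦ Γ' hT' hκ hsq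
  ------------------------------------------------------------------
  -- names for the series
  ------------------------------------------------------------------
  set zQ : PowerSeries ℚ := PowerSeries.map (Int.castRingHom ℚ) zq with hzQ
  set zC : PowerSeries ℂ := PowerSeries.map (Int.castRingHom ℂ) zq with hzC
  set Xz : PowerSeries ℚ := W₀.formalXMulSq.subst zQ with hXz
  set Bz : PowerSeries ℚ := B.subst zQ with hBz
  set PΦ : PowerSeries ℂ := qExpansion 1 (Φ₁ : ℍ → ℂ) with hPΦ
  set PG : PowerSeries ℂ := qExpansion 1 (G₁ : ℍ → ℂ) with hPG
  set Pκ : PowerSeries ℂ := qExpansion 1 (hκ : ℍ → ℂ) with hPκ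
  set PU : PowerSeries ℂ := PowerSeries.map (algebraMap ℚ ℂ) U with hPU
  have hinj : Function.Injective (algebraMap ℚ ℂ) := (algebraMap ℚ ℂ).injective
  have hzQ0 : constantCoeff zQ = 0 := by rw [hzQ, constantCoeff_map', hz0, map_zero]
  have hsQ : HasSubst zQ := HasSubst.of_constantCoeff_zero' hzQ0
  have hzCQ : PowerSeries.map (algebraMap ℚ ℂ) zQ = zC := map_rat_map_int zq
  -- `qExpansion 1 u = PU`
  have hPUeq : qExpansion 1 u = PU := by
    ext n
    rw [hUq n, hPU, coeff_map, eq_ratCast]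
  -- `zq = X * v`, `v(0) ≠ 0`
  obtain ⟨v, hv⟩ : X ∣ zq := X_dvd_iff.mpr hz0
  have hv0 : constantCoeff v ≠ 0 := by
    have h1 := congrArg (coeff 1) hv
    rw [coeff_succ_X_mul, coeff_zero_eq_constantCoeff] at h1
    rwa [h1] at hz1
  have hzC_eq : zC = X * PowerSeries.map (Int.castRingHom ℂ) v := by
    rw [hzC, hv, map_mul, map_X]
  have hzC_ne : zC ≠ 0 := by
    intro h0
    have h1 := congrArg (coeff 1) h0
    rw [hzC, coeff_map, map_zero, eq_intCast, Int.cast_eq_zero] at h1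
    exact hz1 h1
  ------------------------------------------------------------------
  -- (a) rationality of `PΦ` (as in `KummerAlg.stub_kummerAlg`)
  ------------------------------------------------------------------
  obtain ⟨PGq, hPGq⟩ := exists_map_eq_of_forall_rat hGrat
  have hRat : PΦ * (PowerSeries.map (Int.castRingHom ℂ) v) ^ 2 * X ^ 2 = PowerSeries.map (algebraMap ℚ ℂ) (Xz * PGq) := by
    rw [map_mul, hPGq, ← hi, hzC_eq]
    ring
  have hlow : ∀ m' < 2, coeff m' (Xz * PGq) = 0 := by
    intro m' hm'
    apply hinj
    rw [← coeff_map, ← hRat, coeff_mul_X_pow', if_neg (by omega), map_zero]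
  obtain ⟨Q, hQ⟩ : X ^ 2 ∣ Xz * PGq := X_pow_dvd_iff.mpr hlow
  have hPΦv : PΦ * (PowerSeries.map (Int.castRingHom ℂ) v) ^ 2 = PowerSeries.map (algebraMap ℚ ℂ) Q := by
    have h1 : PΦ * (PowerSeries.map (Int.castRingHom ℂ) v) ^ 2 * X ^ 2 = PowerSeries.map (algebraMap ℚ ℂ) Q * X ^ 2 := by
      rw [hRat, hQ, map_mul, map_pow, map_X, mul_comm]
    exact mul_right_cancel₀ (pow_ne_zero 2 X_ne_zero) h1
  set vQ : PowerSeries ℚ := PowerSeries.map (Int.castRingHom ℚ) v with hvQ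
  have hvQ0 : constantCoeff vQ ≠ 0 := by
    rw [hvQ, constantCoeff_map', eq_intCast]
    exact_mod_cast hv0
  have hvC : PowerSeries.map (algebraMap ℚ ℂ) vQ = PowerSeries.map (Int.castRingHom ℂ) v := map_rat_map_int v
  have hPΦrat_eq : PΦ = PowerSeries.map (algebraMap ℚ ℂ) (Q * (vQ⁻¹) ^ 2) := by
    have hne : (PowerSeries.map (Int.castRingHom ℂ) v) ^ 2 ≠ 0 := by
      refine pow_ne_zero 2 fun h0 ↦ hv0 ?_
      have h1 := congrArg constantCoeff h0
      rw [constantCoeff_map', map_zero, eq_intCast, Int.cast_eq_zero] at h1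
      exact h1
    refine mul_right_cancel₀ hne ?_
    rw [hPΦv, ← hvC, ← map_pow, ← map_mul, mul_assoc, ← mul_pow, PowerSeries.inv_mul_cancel vQ hvQ0, one_pow,
      mul_one]
  have hΦrat : ∀ n : ℕ, ∃ r : ℚ, coeff n (qExpansion 1 (Φ₁ : ℍ → ℂ)) = (r : ℂ) := fun n ↦ by
    rw [← hPΦ, hPΦrat_eq]; exact forall_rat_of_map _ n
  -- bounded denominators for `Φ₁`
  obtain ⟨D, hD0, hDint⟩ := hS4 k hk1 Φ₁ hΦrat
  have hDint' : ∀ n : ℕ, ∃ z : ℤ, coeff n (C (D : ℂ) * PΦ) = (z : ℂ) := by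
    intro n
    rw [hPΦ, ← hlinΦ (D : ℂ)]
    exact hDint n
  obtain ⟨TΦ, hTΦ⟩ := exists_map_eq_of_forall_int hDint'
  ------------------------------------------------------------------
  -- (b) the square identity `(q·X·P(h))² = (X^m·E·R·PG)²`
  ------------------------------------------------------------------
  -- `Bz² = (X_W − x₀T²)(Z)` and the (Θ) identity over `ℂ`
  have hBz2 : Bz ^ 2 = (W₀.formalXMulSq - C x₀ * X ^ 2).subst zQ := by
    rw [hBz, ← subst_pow hsQ, hBsq]
  have hΘC : PowerSeries.map (Int.castRingHom ℂ) (kummerThetaSeries N) * (PowerSeries.map (algebraMap ℚ ℂ) Bz) ^ 2 =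
      (PowerSeries.map (Int.castRingHom ℂ) R) ^ 2 := by
    have h1 := congrArg (PowerSeries.map (algebraMap ℚ ℂ)) hR
    rw [← hzq, ← hBz2] at h1
    simp only [map_mul, map_pow, map_rat_map_int] at h1
    exact h1
  -- `PU² = X^{2m}·Θ·E²`
  have hPU2 : PU ^ 2 = X ^ (2 * m) * PowerSeries.map (Int.castRingHom ℂ) (kummerThetaSeries N) *
      (PowerSeries.map (Int.castRingHom ℂ) E) ^ 2 := by
    rw [hPU, ← map_pow, hUsq, map_rat_map_int, map_mul, map_mul, map_pow, map_pow, map_X]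
  -- `P(h) = PU · Pκ`
  have hPh : qExpansion 1 (h : ℍ → ℂ) = PU * Pκ := by rw [hhq, hPUeq]
  -- `(zB(z))² PG²` over `ℂ`
  have hii' : Pκ ^ 2 * zC ^ 4 = (zC * PowerSeries.map (algebraMap ℚ ℂ) Bz) ^ 2 * PG ^ 2 := by
    have h2 := hii
    rw [map_mul, hzCQ] at h2
    exact h2
  have hsqid : (qExpansion 1 (h : ℍ → ℂ) * zC ^ 2) * (qExpansion 1 (h : ℍ → ℂ) * zC ^ 2) =
      (X ^ m * PowerSeries.map (Int.castRingHom ℂ) E * PowerSeries.map (Int.castRingHom ℂ) R * PG * zC) *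
        (X ^ m * PowerSeries.map (Int.castRingHom ℂ) E * PowerSeries.map (Int.castRingHom ℂ) R * PG * zC) := by
    have e1 : (qExpansion 1 (h : ℍ → ℂ) * zC ^ 2) * (qExpansion 1 (h : ℍ → ℂ) * zC ^ 2) = PU ^ 2 * (Pκ ^ 2 * zC ^ 4) := by
      rw [hPh]; ring
    rw [e1, hii', hPU2]
    have e2 : X ^ (2 * m) * PowerSeries.map (Int.castRingHom ℂ) (kummerThetaSeries N) * (PowerSeries.map (Int.castRingHom ℂ) E) ^ 2 *
        ((zC * PowerSeries.map (algebraMap ℚ ℂ) Bz) ^ 2 * PG ^ 2) =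
        X ^ (2 * m) * (PowerSeries.map (Int.castRingHom ℂ) E) ^ 2 * PG ^ 2 * zC ^ 2 *
          (PowerSeries.map (Int.castRingHom ℂ) (kummerThetaSeries N) * (PowerSeries.map (algebraMap ℚ ℂ) Bz) ^ 2) := by ring
    rw [e2, hΘC]
    ring
  -- a sign `ε = ±1`
  obtain ⟨ε, hε⟩ : ∃ ε : ℤ, qExpansion 1 (h : ℍ → ℂ) * zC ^ 2 =
      C (ε : ℂ) * (X ^ m * PowerSeries.map (Int.castRingHom ℂ) E * PowerSeries.map (Int.castRingHom ℂ) R * PG * zC) := by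
    rcases mul_self_eq_mul_self_iff.mp hsqid with h1 | h1
    · exact ⟨1, by rw [h1, Int.cast_one, map_one, one_mul]⟩
    · exact ⟨-1, by rw [h1, Int.cast_neg, Int.cast_one, map_neg, map_one, neg_one_mul]⟩
  ------------------------------------------------------------------
  -- (c) integrality: `PG = PΦ·z²·X(z)⁻¹`, `D·PΦ ∈ ℤ⟦q⟧`, `z = X·v`
  ------------------------------------------------------------------
  obtain ⟨Xℤ, hXℤ0, hXℤ⟩ := exists_int_formalXMulSq W₀
  set Xℤz : PowerSeries ℤ := Xℤ.subst zq with hXℤz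
  have hXℤz_map : PowerSeries.map (Int.castRingHom ℂ) Xℤz = PowerSeries.map (algebraMap ℚ ℂ) Xz := by
    rw [hXℤz, map_int_subst hz0, hXz, map_rat_subst hzQ0, ← hXℤ]
    simp only [hzQ, map_rat_map_int]
  have hXℤz0 : constantCoeff Xℤz = 1 := by
    rw [hXℤz, Literature.RingTheory.PowerSeries.constantCoeff_subst_of_constantCoeff_eq_zero hz0, hXℤ0]
  set Y : PowerSeries ℤ := Xℤz.invOfUnit 1 with hY
  have hXY : Xℤz * Y = 1 := PowerSeries.mul_invOfUnit Xℤz 1 (by rw [hXℤz0, Units.val_one])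
  have hPGeq : PG = PΦ * zC ^ 2 * PowerSeries.map (Int.castRingHom ℂ) Y := by
    calc PG = PG * PowerSeries.map (Int.castRingHom ℂ) (Xℤz * Y) := by rw [hXY, map_one, mul_one]
      _ = (PowerSeries.map (algebraMap ℚ ℂ) Xz * PG) * PowerSeries.map (Int.castRingHom ℂ) Y := by
          rw [map_mul, hXℤz_map]; ring
      _ = PΦ * zC ^ 2 * PowerSeries.map (Int.castRingHom ℂ) Y := by rw [← hi]
  -- assemble: `P(h)·z² = ε·X^m·E·R·PΦ·z³·Y`, cancel `z²`, multiply by `D`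
  have hmain : qExpansion 1 (h : ℍ → ℂ) * zC ^ 2 =
      (C (ε : ℂ) * X ^ m * PowerSeries.map (Int.castRingHom ℂ) E * PowerSeries.map (Int.castRingHom ℂ) R * PΦ * zC *
        PowerSeries.map (Int.castRingHom ℂ) Y) * zC ^ 2 := by
    rw [hε, hPGeq]; ring
  have hmain' : C (D : ℂ) * qExpansion 1 (h : ℍ → ℂ) =
      C (ε : ℂ) * PowerSeries.map (Int.castRingHom ℂ) (X ^ m * E * R * TΦ * zq * Y) := by
    have h1 := mul_right_cancel₀ (pow_ne_zero 2 hzC_ne) hmain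
    have hTΦ' : C (D : ℂ) * PΦ = PowerSeries.map (Int.castRingHom ℂ) TΦ := hTΦ.symm
    rw [h1]
    simp only [map_mul, map_pow, map_X, ← hzC]
    linear_combination (C (ε : ℂ) * X ^ m * PowerSeries.map (Int.castRingHom ℂ) E * PowerSeries.map (Int.castRingHom ℂ) R *
      zC * PowerSeries.map (Int.castRingHom ℂ) Y) * hTΦ'
  ------------------------------------------------------------------
  -- (d) conclusion with `M = D`
  ------------------------------------------------------------------
  refine ⟨((12 * m : ℕ) : ℤ) + k, h, D, hh0, hhanti, hD0, fun n ↦ ?_⟩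
  -- linearity of the `q`-expansion of `h`
  have hTΓ'' : ModularGroup.T ∈ Γ'' := by
    obtain ⟨hT0, hT1, hTκ⟩ := (hΓ' _).mp hT'
    obtain ⟨nT, hnT, hnTe⟩ := hcusp _ (UBD.T_mem_Gamma1 N) trace_T
    exact (hΓ''c _).mpr ⟨hT0, hT1, ⟨fun _ ↦ hTκ, fun _ ↦ ⟨nT, hnT, hnTe⟩⟩⟩
  have hhT : (h : ℍ → ℂ) ∣[((12 * m : ℕ) : ℤ) + k] ModularGroup.T = h :=
    SlashInvariantForm.slash_action_eqn h _ ⟨ModularGroup.T, hTΓ'', rfl⟩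
  have hh_per : Function.Periodic ((h : ℍ → ℂ) ∘ ofComplex) 1 := periodic_of_slash_T hhT
  have hh_bdd : IsBoundedAtImInfty (h : ℍ → ℂ) := by
    refine (isZeroAtImInfty_of_norm_sq' (V := fun τ ↦ V τ * (Ψ τ * G₁ τ)) (fun τ ↦ ?_) ?_).boundedAtFilter
    · rw [hhdef τ, norm_mul, mul_pow, ← norm_pow, ← norm_pow, husq τ, hsq' τ, ← norm_mul]
    · exact isZeroAtImInfty_mul_of_bdd (isBoundedAtImInfty_modularForm_gamma0 V)
        (isZeroAtImInfty_mul_of_bdd (isZeroAtImInfty_cuspForm_gamma1 Ψ).boundedAtFilter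
          (isZeroAtImInfty_cuspForm_gamma1 G₁))
  have hh_an : AnalyticAt ℂ (cuspFunction 1 (h : ℍ → ℂ)) 0 :=
    UpperHalfPlane.analyticAt_cuspFunction_zero one_pos hh_per h.holo' hh_bdd
  have hlin : qExpansion (1 : ℝ) (fun τ : ℍ ↦ (D : ℂ) * h τ) = C (D : ℂ) * qExpansion 1 (h : ℍ → ℂ) := by
    have hfun : (fun τ : ℍ ↦ (D : ℂ) * h τ) = (D : ℂ) • (h : ℍ → ℂ) := by
      funext τ; simp [smul_eq_mul]
    rw [hfun, UpperHalfPlane.qExpansion_smul hh_an, smul_eq_C_mul]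
  have hfinal : C (D : ℂ) * qExpansion 1 (h : ℍ → ℂ) =
      PowerSeries.map (Int.castRingHom ℂ) (((ε : ℤ) : PowerSeries ℤ) * (X ^ m * E * R * TΦ * zq * Y)) := by
    rw [hmain']
    simp only [map_mul, map_intCast]
  exact ⟨coeff n (((ε : ℤ) : PowerSeries ℤ) * (X ^ m * E * R * TΦ * zq * Y)), by rw [hlin, hfinal, coeff_map, eq_intCast]⟩

end Summit.BirchSwinnertonDyer.BirchSwinnertonDyer.Theorems.DepletionAtTwo.KummerSigma

end
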